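import Literature.AnabelianGeometry.AbsoluteAnabelian.AbsTopIII.LinearSystemsWitnessProofs
import HarnessLib

/-!
# [AbsTopIII] Prop. 1.3 — proofs, part 3: transport along an isomorphism of triples; discharge

Mochizuki, *Topics in Absolute Anabelian Geometry III*, §1, Proposition 1.3 (Additive Structure via
Valuation and Evaluation Maps), manuscript pp. 30–31 (lit key `paper:url-5493eb38cbb7`).  Third and
last PROOF-ONLY companion of `AbsTopIII/LinearSystems.lean` (abc-iut-L4-t1; companion name per
abc-iut-L4-lead ruling ξ (4)): the DISCHARGE
`Prop_1_3_holds : Prop_1_3` of the named fact `Prop_1_3` — every isomorphism `(φ, σ)` between the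
triples `(K^×, {ord_v}, {U_v})` of the function fields of two proper curves over algebraically
closed fields (`ValuationEvaluationData.IsIso`, the "functoriality" clause of Prop. 1.3) extends
(with `0 ↦ 0`) to a field isomorphism `K ≃+* K'`.  Steps:

* `IsIso.symm`, `IsIso.symm_fnField` — the inverse pair is again an isomorphism of triples;
* `IsIso.exists_constEquiv` — `φ` restricts to a group isomorphism `φ₀ : k^× ≃ k'^×` of constants
  (printed: "`k^× = ⋂_v Ker(v)`");
* `IsIso.hasValue_iff` — evaluation is transported: `f(x) = λ ⟺ (φ f)(σ x) = φ₀ λ`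
  (printed: "`Ker(v) = U_v × k^×` [...] allows us to evaluate");
* `IsIso.val_constEquiv_add`, `IsIso.val_constEquiv_neg`, `IsIso.map_neg_one` — `φ₀` is additive
  (printed: "construct the additive structure of `k^×`"), by transporting the multiplicative
  characterisation of `λ + s` of part 2 (`eq_const_add_of_witness`) and reading off values;
* `IsIso.val_map_add`, `IsIso.map_neg` — `φ` is additive on `K^×` (printed: "hence also the
  additive structure of `K_X^×` [i.e., by 'evaluating' at various `v ∈ V_X`]"), via
  `eq_add_of_values` of part 2;
* `Prop_1_3_holds` — the field isomorphism `ψ` extending `φ` by `0 ↦ 0`.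

No new definitions (proof-only companion); the group isomorphism `φ₀` is delivered by an
existence theorem.  The hypotheses `2 ≤ genus` of `Prop_1_3` are not used.
-/

noncomputable section

open scoped Classical

namespace Literature.AnabelianGeometry.AbsoluteAnabelian.AbsTopIII

open Literature.NumberTheory.DiophantineGeometry
open Literature.NumberTheory.DiophantineGeometry.AlgFunctionField

universe u v w

/-- The constants embed injectively into the units: `constUnits k K` is injective.
[cite: MochizukiAbsTopIII2015, Prop 1.1 (i) p.29] -/
theorem constUnits_injective (k : Type u) (K : Type v) [Field k] [Field K] [Algebra k K] :
    Function.Injective (constUnits k K) := by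
  intro a b h
  have h' : algebraMap k K a = algebraMap k K b := by
    simpa [constUnits] using congrArg (fun u : Kˣ => (u : K)) h
  exact Units.ext ((algebraMap k K).injective h')

/-- `constUnits k K (−1) = −1`. [cite: MochizukiAbsTopIII2015, Prop 1.1 (i) p.29] -/
theorem constUnits_neg_one (k : Type u) (K : Type v) [Field k] [Field K] [Algebra k K] :
    constUnits k K (-1) = -1 :=
  Units.ext (by simp [constUnits])

namespace ValuationEvaluationData.IsIso

/-! ### Generic: the inverse of an isomorphism of triples -/

/-- The inverse `(φ⁻¹, σ⁻¹)` of an isomorphism of triples is an isomorphism of triples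
("isomorphisms [in the evident sense] of such triples", p. 30).
[cite: MochizukiAbsTopIII2015, Prop 1.3 p.30] -/
theorem symm {T T' : ValuationEvaluationData.{v}} {φ : T.G ≃* T'.G} {σ : T.I ≃ T'.I}
    (hiso : T.IsIso T' φ σ) : T'.IsIso T φ.symm σ.symm := by
  refine ⟨fun i' g' => ?_, fun i' => ?_⟩
  · have h := hiso.ord_comp (σ.symm i') (φ.symm g')
    rw [Equiv.apply_symm_apply, MulEquiv.apply_symm_apply] at h
    exact h.symm
  · have h := hiso.map_U (σ.symm i')
    rw [Equiv.apply_symm_apply] at h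
    rw [h, Subgroup.map_map]
    ext x
    simp only [Subgroup.mem_map, MonoidHom.coe_comp, MulEquiv.coe_toMonoidHom,
      Function.comp_apply, MulEquiv.symm_apply_apply, exists_eq_right]

/-! ### The triples of two function fields -/

variable {k : Type u} {K : Type v} [Field k] [Field K] [Algebra k K]
  {k' : Type w} {K' : Type v} [Field k'] [Field K'] [Algebra k' K']
  {φ : Kˣ ≃* K'ˣ} {σ : PlaceOver k K ≃ PlaceOver k' K'}

/-- Compatibility with the valuations, unfolded: `ord_{σ v}(φ f) = ord_v(f)`.
[cite: MochizukiAbsTopIII2015, Prop 1.3 (b) p.30] -/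
theorem ord_eq (hiso : (valuationEvaluationData k K).IsIso (valuationEvaluationData k' K') φ σ)
    (v : PlaceOver k K) (f : Kˣ) : (σ v).ord ((φ f : K'ˣ) : K') = v.ord (f : K) :=
  hiso.ord_comp v f

/-- Compatibility with the subgroups `U_v`, unfolded: `φ f ∈ U_{σ v} ⟺ f ∈ U_v`.
[cite: MochizukiAbsTopIII2015, Prop 1.3 (c) p.30] -/
theorem map_mem_unitsWithValueOne_iff
    (hiso : (valuationEvaluationData k K).IsIso (valuationEvaluationData k' K') φ σ)
    (v : PlaceOver k K) (f : Kˣ) : φ f ∈ unitsWithValueOne (σ v) ↔ f ∈ unitsWithValueOne v := by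
  have h := hiso.map_U v
  change unitsWithValueOne (σ v) = (unitsWithValueOne v).map φ.toMonoidHom at h
  rw [h, Subgroup.mem_map_equiv, MulEquiv.symm_apply_apply]

/-- The inverse `(φ⁻¹, σ⁻¹)` of an isomorphism between the triples of two function fields is an
isomorphism of triples (`IsIso.symm`, restated so that `φ⁻¹ : K'^× ≃ K^×` carries the standard
group structure of units). [cite: MochizukiAbsTopIII2015, Prop 1.3 p.30] -/
theorem symm_fnField
    (hiso : (valuationEvaluationData k K).IsIso (valuationEvaluationData k' K') φ σ) :
    (valuationEvaluationData k' K').IsIso (valuationEvaluationData k K) φ.symm σ.symm :=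
  hiso.symm

/-- `(φ f)(σ x) = 1 ⟺ f(x) = 1` (the subgroups `U_v` correspond).
[cite: MochizukiAbsTopIII2015, Prop 1.3 (c) p.30] -/
theorem hasValue_one_iff
    (hiso : (valuationEvaluationData k K).IsIso (valuationEvaluationData k' K') φ σ)
    (v : PlaceOver k K) (f : Kˣ) : HasValue (σ v) ((φ f : K'ˣ) : K') 1 ↔ HasValue v (f : K) 1 :=
  (mem_unitsWithValueOne_iff (σ v) (φ f)).symm.trans
    ((hiso.map_mem_unitsWithValueOne_iff v f).trans (mem_unitsWithValueOne_iff v f))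

/-- "`k^× ⊆ K_X^×` may be constructed as `⋂_v Ker(v)`" — hence `φ` maps constants to constants.
[cite: MochizukiAbsTopIII2015, Prop 1.3 p.30] -/
theorem exists_constUnits_eq [IsAlgClosed k] [IsAlgFunctionField k K] [IsAlgClosed k']
    [IsAlgFunctionField k' K']
    (hiso : (valuationEvaluationData k K).IsIso (valuationEvaluationData k' K') φ σ) (c : kˣ) :
    ∃ c' : k'ˣ, constUnits k' K' c' = φ (constUnits k K c) := by
  rw [exists_constUnits_eq_iff_forall_ord_eq_zero]
  intro v'
  obtain ⟨v, rfl⟩ := σ.surjective v'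
  rw [hiso.ord_eq]
  exact PlaceOver.ord_algebraMap_holds v c.ne_zero

/-- The isomorphism of constants: `φ` restricts to a group isomorphism `φ₀ : k^× ≃ k'^×` with
`φ(λ) = φ₀(λ)` inside `K'^×`. [cite: MochizukiAbsTopIII2015, Prop 1.3 p.30] -/
theorem exists_constEquiv [IsAlgClosed k] [IsAlgFunctionField k K] [IsAlgClosed k']
    [IsAlgFunctionField k' K']
    (hiso : (valuationEvaluationData k K).IsIso (valuationEvaluationData k' K') φ σ) :
    ∃ φ₀ : kˣ ≃* k'ˣ, ∀ c : kˣ, φ (constUnits k K c) = constUnits k' K' (φ₀ c) := by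
  choose f hf using hiso.exists_constUnits_eq
  choose g hg using hiso.symm_fnField.exists_constUnits_eq
  have hinj := constUnits_injective k K
  have hinj' := constUnits_injective k' K'
  refine ⟨{ toFun := f, invFun := g, left_inv := ?_, right_inv := ?_, map_mul' := ?_ },
    fun c => (hf c).symm⟩
  · intro c
    apply hinj
    rw [hg, hf, MulEquiv.symm_apply_apply]
  · intro c'
    apply hinj'
    have h1 := hg c'
    rw [MulEquiv.eq_symm_apply] at h1
    rw [hf, h1]
  · intro a b
    apply hinj'
    rw [hf, map_mul, map_mul, map_mul, hf, hf]

/-- Transport of evaluation: for `f ∈ K^×`, `λ ∈ k^×`, `(φ f)(σ x) = φ₀ λ ⟺ f(x) = λ`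
("`Ker(v) = U_v × k^×` [...] allows us to evaluate elements of `Ker(v)`").
[cite: MochizukiAbsTopIII2015, Prop 1.3 p.30] -/
theorem hasValue_iff
    (hiso : (valuationEvaluationData k K).IsIso (valuationEvaluationData k' K') φ σ)
    {φ₀ : kˣ ≃* k'ˣ} (hφ₀ : ∀ c : kˣ, φ (constUnits k K c) = constUnits k' K' (φ₀ c))
    (v : PlaceOver k K) (f : Kˣ) (c : kˣ) :
    HasValue (σ v) ((φ f : K'ˣ) : K') (φ₀ c : k') ↔ HasValue v (f : K) c := by
  rw [hasValue_iff_mul_inv_mem_unitsWithValueOne, hasValue_iff_mul_inv_mem_unitsWithValueOne,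
    ← hφ₀, ← map_inv, ← map_mul, hiso.map_mem_unitsWithValueOne_iff]

/-- The constants isomorphism of the inverse isomorphism of triples is `φ₀⁻¹`.
[cite: MochizukiAbsTopIII2015, Prop 1.3 p.30] -/
theorem symm_constUnits
    {φ₀ : kˣ ≃* k'ˣ} (hφ₀ : ∀ c : kˣ, φ (constUnits k K c) = constUnits k' K' (φ₀ c))
    (c' : k'ˣ) : φ.symm (constUnits k' K' c') = constUnits k K (φ₀.symm c') := by
  rw [MulEquiv.symm_apply_eq, hφ₀, MulEquiv.apply_symm_apply]

/-- ADDITIVITY OF `φ₀` ("construct the additive structure of `k^×`", p. 31): for `λ, μ ∈ k^×`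
with `λ + μ ≠ 0`, `φ₀(λ + μ) = φ₀ λ + φ₀ μ`.  Proof: take `s` with simple poles and `x` with
`s(x) = μ` (part 2); `h := λ + s` is characterised by data preserved by `(φ, σ)`
(`eq_const_add_of_witness`), so `φ h = φ₀ λ + φ s`; evaluating at `σ x` gives the claim.
[cite: MochizukiAbsTopIII2015, Prop 1.3 p.31] -/
theorem val_constEquiv_add [IsAlgClosed k] [IsAlgFunctionField k K] [IsAlgClosed k']
    [IsAlgFunctionField k' K']
    (hiso : (valuationEvaluationData k K).IsIso (valuationEvaluationData k' K') φ σ)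
    {φ₀ : kˣ ≃* k'ˣ} (hφ₀ : ∀ c : kˣ, φ (constUnits k K c) = constUnits k' K' (φ₀ c))
    (a b : kˣ) (hab : (a : k) + b ≠ 0) :
    ((φ₀ (Units.mk0 ((a : k) + b) hab) : k'ˣ) : k') = (φ₀ a : k') + (φ₀ b : k') := by
  -- witnesses in `K`
  obtain ⟨s, hs, hpole, hsimple⟩ := exists_fn_simple_poles (k := k) (K := K)
  obtain ⟨hh, w1, w2, w3⟩ := witness_const_add (k := k) hs a.ne_zero hpole
  obtain ⟨x, hxs⟩ := exists_place_hasValue hs b.ne_zero hpole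
  have hxh : HasValue x (algebraMap k K a + s) ((a : k) + b) := (hasValue_algebraMap x a).add hxs
  set S : Kˣ := Units.mk0 s hs with hS
  set H : Kˣ := Units.mk0 (algebraMap k K a + s) hh with hH
  -- transport the characterisation of `h = λ + s` to `K'`
  have key : ((φ H : K'ˣ) : K') = algebraMap k' K' (φ₀ a : k') + ((φ S : K'ˣ) : K') := by
    refine eq_const_add_of_witness (k := k') (K := K') (φ S).ne_zero (φ H).ne_zero ?_ ?_ ?_ ?_ ?_
    · obtain ⟨w, hw⟩ := hpole
      exact ⟨σ w, by rw [hiso.ord_eq]; exact hw⟩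
    · intro v'
      obtain ⟨v, rfl⟩ := σ.surjective v'
      rw [hiso.ord_eq]
      exact hsimple v
    · intro v' hv'
      obtain ⟨v, rfl⟩ := σ.surjective v'
      rw [hiso.ord_eq] at hv'
      have h1 : HasValue v (((H / S : Kˣ) : K)) 1 := by
        rw [Units.val_div_eq_div_val]
        exact w1 v hv'
      have := (hiso.hasValue_one_iff v (H / S)).2 h1
      rwa [map_div, Units.val_div_eq_div_val] at this
    · intro v' hv'
      obtain ⟨v, rfl⟩ := σ.surjective v'
      rw [hiso.ord_eq] at hv'
      exact (hiso.hasValue_iff hφ₀ v H a).2 (w2 v hv')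
    · intro v' hv'
      obtain ⟨v, rfl⟩ := σ.surjective v'
      rw [hiso.ord_eq] at hv' ⊢
      exact w3 v hv'
  -- evaluate at `σ x`
  have h1 : HasValue (σ x) ((φ H : K'ˣ) : K') ((φ₀ a : k') + (φ₀ b : k')) := by
    rw [key]
    exact (hasValue_algebraMap (σ x) _).add ((hiso.hasValue_iff hφ₀ x S b).2 hxs)
  have h2 : HasValue (σ x) ((φ H : K'ˣ) : K') (φ₀ (Units.mk0 ((a : k) + b) hab) : k') :=
    (hiso.hasValue_iff hφ₀ x H _).2 hxh
  exact h2.unique h1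

/-- `φ₀(−λ) = −φ₀(λ)`: otherwise `φ₀ λ + φ₀(−λ) ≠ 0`, and additivity of the constants isomorphism
`φ₀⁻¹` of the INVERSE isomorphism of triples would give `λ + (−λ) ≠ 0`.
[cite: MochizukiAbsTopIII2015, Prop 1.3 p.31] -/
theorem val_constEquiv_neg [IsAlgClosed k] [IsAlgFunctionField k K] [IsAlgClosed k']
    [IsAlgFunctionField k' K']
    (hiso : (valuationEvaluationData k K).IsIso (valuationEvaluationData k' K') φ σ)
    {φ₀ : kˣ ≃* k'ˣ} (hφ₀ : ∀ c : kˣ, φ (constUnits k K c) = constUnits k' K' (φ₀ c))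
    (a : kˣ) : ((φ₀ (-a) : k'ˣ) : k') = -(φ₀ a : k') := by
  by_contra hne
  have hsum : ((φ₀ a : k'ˣ) : k') + (φ₀ (-a) : k') ≠ 0 := fun h0 =>
    hne (eq_neg_of_add_eq_zero_right h0)
  have h := hiso.symm_fnField.val_constEquiv_add (symm_constUnits hφ₀) (φ₀ a) (φ₀ (-a)) hsum
  rw [MulEquiv.symm_apply_apply, MulEquiv.symm_apply_apply, Units.val_neg, add_neg_cancel] at h
  exact (φ₀.symm _).ne_zero h

/-- `φ(−1) = −1`. [cite: MochizukiAbsTopIII2015, Prop 1.3 p.31] -/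
theorem map_neg_one [IsAlgClosed k] [IsAlgFunctionField k K] [IsAlgClosed k']
    [IsAlgFunctionField k' K']
    (hiso : (valuationEvaluationData k K).IsIso (valuationEvaluationData k' K') φ σ)
    {φ₀ : kˣ ≃* k'ˣ} (hφ₀ : ∀ c : kˣ, φ (constUnits k K c) = constUnits k' K' (φ₀ c)) :
    φ (-1) = -1 := by
  have h1 : φ₀ (-1) = -1 := by
    apply Units.ext
    rw [hiso.val_constEquiv_neg hφ₀ 1, map_one, Units.val_neg, Units.val_one]
  rw [← constUnits_neg_one k K, hφ₀, h1, constUnits_neg_one]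

/-! ### Transport of addition on `K^×` -/

/-- `φ` IS ADDITIVE on `K^×`: for `f, g ∈ K^×` with `f + g ≠ 0`, `φ(f + g) = φ f + φ g`.  The
relation `h = f + g` is characterised by `h(x) = f(x) + g(x)` at the common invertibility points
(`eq_add_of_values`); values are transported by `(φ, σ)` (`hasValue_iff`) and sums of constants by
the additivity of `φ₀` (`val_constEquiv_add`). [cite: MochizukiAbsTopIII2015, Prop 1.3 p.31] -/
theorem val_map_add [IsAlgClosed k] [IsAlgFunctionField k K] [IsAlgClosed k']
    [IsAlgFunctionField k' K']
    (hiso : (valuationEvaluationData k K).IsIso (valuationEvaluationData k' K') φ σ)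
    {φ₀ : kˣ ≃* k'ˣ} (hφ₀ : ∀ c : kˣ, φ (constUnits k K c) = constUnits k' K' (φ₀ c))
    (f g : Kˣ) (hfg : (f : K) + g ≠ 0) :
    ((φ (Units.mk0 ((f : K) + g) hfg) : K'ˣ) : K') = (φ f : K') + (φ g : K') := by
  refine eq_add_of_values (k := k') (K := K') (φ f).ne_zero (φ g).ne_zero (φ _).ne_zero ?_
  intro v' a' b' c' ha0 hb0 hc0 hFa hGb hHc
  obtain ⟨v, rfl⟩ := σ.surjective v'
  obtain ⟨a, rfl⟩ : ∃ a : kˣ, ((φ₀ a : k'ˣ) : k') = a' := ⟨φ₀.symm (Units.mk0 a' ha0), by simp⟩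
  obtain ⟨b, rfl⟩ : ∃ b : kˣ, ((φ₀ b : k'ˣ) : k') = b' := ⟨φ₀.symm (Units.mk0 b' hb0), by simp⟩
  obtain ⟨c, rfl⟩ : ∃ c : kˣ, ((φ₀ c : k'ˣ) : k') = c' := ⟨φ₀.symm (Units.mk0 c' hc0), by simp⟩
  rw [hiso.hasValue_iff hφ₀] at hFa hGb hHc
  rw [Units.val_mk0] at hHc
  have hcab : (c : k) = a + b := hHc.unique (hFa.add hGb)
  have hab : (a : k) + b ≠ 0 := hcab ▸ c.ne_zero
  have hc_eq : c = Units.mk0 ((a : k) + b) hab := Units.ext hcab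
  rw [hc_eq, hiso.val_constEquiv_add hφ₀ a b hab]

/-- `φ(−f) = −φ(f)` on `K^×` (from `φ(−1) = −1`). [cite: MochizukiAbsTopIII2015, Prop 1.3 p.31] -/
theorem map_neg [IsAlgClosed k] [IsAlgFunctionField k K] [IsAlgClosed k']
    [IsAlgFunctionField k' K']
    (hiso : (valuationEvaluationData k K).IsIso (valuationEvaluationData k' K') φ σ)
    {φ₀ : kˣ ≃* k'ˣ} (hφ₀ : ∀ c : kˣ, φ (constUnits k K c) = constUnits k' K' (φ₀ c))
    (f : Kˣ) : φ (-f) = -φ f := by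
  rw [← neg_one_mul, map_mul, hiso.map_neg_one hφ₀, neg_one_mul]

end ValuationEvaluationData.IsIso

/-! ### The discharge -/

/-- **[AbsTopIII] Proposition 1.3, PROVED** (discharge of the named fact `Prop_1_3` of
`AbsTopIII/LinearSystems.lean`, in its typed transport form): for the function fields `K/k`,
`K'/k'` of proper hyperbolic curves over algebraically closed fields, every isomorphism
`(φ, σ)` between their triples ((a) the group `K^×`, (b) the valuations `ord_x`, `x ∈ X(k)`,
(c) the subgroups `U_v = {f | f(x) = 1}`) extends, with `0 ↦ 0`, to a field isomorphism
`ψ : K ≃+* K'` — "there exists a functorial algorithm for constructing the additive structure on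
`K_X^× ∪ {0}` from the data (a), (b), (c)".  Proof (pp. 30–31, with the linear systems of
Prop. 1.2 replaced by the function `λ + s` of part 2): constants `k^× = ⋂ Ker(ord_v)` and
evaluation `Ker(ord_v) = U_v × k^×` are preserved, the additive structure of `k` is recovered
from the characterisation of `λ + s`, and that of `K` by evaluating at points.

HYPOTHESES UNUSED (reported to abc-iut-L4-lead / referee lane F, PASS-F2): the hypotheses
`2 ≤ genus k K`, `2 ≤ genus k' K'` of `Prop_1_3` are NOT used — the typed statement holds for
every algebraic function field of one variable over an algebraically closed field (genus `0`, `1`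
included); and the named facts `Prop_1_1_ii`, `Prop_1_2_i`, `Prop_1_2_ii`, `Prop_1_2_iii` of
`LinearSystems.lean` (the printed route) are NOT invoked — their role is played by
`exists_fn_simple_poles` / `eq_const_add_of_witness` (same Riemann–Roch input, tree
`degree_add_one_sub_genus_le_ell`).  The conclusion is not vacuous: it uses the datum (c) `U_v`
essentially (the data (a), (b) alone do not determine the additive structure).
[cite: MochizukiAbsTopIII2015, Prop 1.3 p.30] -/
theorem Prop_1_3_holds : Prop_1_3.{v} := by
  intro k K _ _ _ _ _ k' K' _ _ _ _ _ _ _ φ σ hiso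
  obtain ⟨φ₀, hφ₀⟩ := hiso.exists_constEquiv
  -- the maps `ψ : K → K'`, `ψ' : K' → K` extending `φ`, `φ⁻¹` by `0 ↦ 0`
  set ψf : K → K' := fun x => if hx : x = 0 then 0 else ((φ (Units.mk0 x hx) : K'ˣ) : K')
    with hψf_def
  set ψg : K' → K := fun y => if hy : y = 0 then 0 else ((φ.symm (Units.mk0 y hy) : Kˣ) : K)
    with hψg_def
  have hψf0 : ψf 0 = 0 := by simp [hψf_def]
  have hψf : ∀ (x : K) (hx : x ≠ 0), ψf x = ((φ (Units.mk0 x hx) : K'ˣ) : K') := fun x hx => by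
    simp [hψf_def, hx]
  have hψg0 : ψg 0 = 0 := by simp [hψg_def]
  have hψg : ∀ (y : K') (hy : y ≠ 0), ψg y = ((φ.symm (Units.mk0 y hy) : Kˣ) : K) :=
    fun y hy => by simp [hψg_def, hy]
  refine ⟨{ toFun := ψf, invFun := ψg, left_inv := ?_, right_inv := ?_,
            map_mul' := ?_, map_add' := ?_ }, fun f => ?_⟩
  · -- left inverse
    intro x
    by_cases hx : x = 0
    · rw [hx, hψf0, hψg0]
    · rw [hψf x hx, hψg _ (φ (Units.mk0 x hx)).ne_zero, Units.mk0_val, MulEquiv.symm_apply_apply,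
        Units.val_mk0]
  · -- right inverse
    intro y
    by_cases hy : y = 0
    · rw [hy, hψg0, hψf0]
    · rw [hψg y hy, hψf _ (φ.symm (Units.mk0 y hy)).ne_zero, Units.mk0_val,
        MulEquiv.apply_symm_apply, Units.val_mk0]
  · -- multiplicativity
    intro x y
    by_cases hx : x = 0
    · rw [hx, zero_mul, hψf0, zero_mul]
    by_cases hy : y = 0
    · rw [hy, mul_zero, hψf0, mul_zero]
    rw [hψf _ (mul_ne_zero hx hy), hψf x hx, hψf y hy, Units.mk0_mul, map_mul, Units.val_mul]
  · -- additivity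
    intro x y
    by_cases hx : x = 0
    · rw [hx, zero_add, hψf0, zero_add]
    by_cases hy : y = 0
    · rw [hy, add_zero, hψf0, add_zero]
    by_cases hxy : x + y = 0
    · have hy' : y = -x := eq_neg_of_add_eq_zero_right hxy
      have hmk : Units.mk0 (-x) (neg_ne_zero.2 hx) = -Units.mk0 x hx := Units.ext rfl
      rw [hxy, hψf0, hψf x hx]
      conv_rhs => rw [hy', hψf _ (neg_ne_zero.2 hx), hmk, hiso.map_neg hφ₀, Units.val_neg,
        add_neg_cancel]
    · rw [hψf _ hxy, hψf x hx, hψf y hy]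
      exact hiso.val_map_add hφ₀ (Units.mk0 x hx) (Units.mk0 y hy) hxy
  · -- `ψ` extends `φ`
    change ψf f = _
    rw [hψf _ f.ne_zero, Units.mk0_val]

end Literature.AnabelianGeometry.AbsoluteAnabelian.AbsTopIII
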